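import Summits.BirchSwinnertonDyer.BirchSwinnertonDyer.Theorems.ByReductionTypeAtTwoRankOneAtTwoBigImageOddLocalOneDoorSubsliceNegDiscFloat
import Summits.BirchSwinnertonDyer.BirchSwinnertonDyer.Theorems.ByReductionTypeAtTwoRankOneAtTwoBigImageOddLocalOneDoorSubslicePosDisc
import HarnessLib

/-!
# Route ByReductionTypeAtTwo, crux `RankOneAtTwoBigImageOddLocal` (stmt-BirchSwinnertonDyer-23715), LINE v8.15/v8.16 `one_door_analytic`:
# THE CONSTANT FLOATS ON THE EGG CLASS TOO — on {`Δ_W > 0`, `Ш(W)[2] = 0`, `MeetsEgg`} the residue is «exponent `= v₂(c)`» at a `Sel₂`-trivial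
# archimedean door for ANY datum; with the `Δ_W < 0` companion the «no odd-constant datum» population of R₊₊ DISAPPEARS:
# crux ⟸ PRINT⁵ + rank-`0` + R⁻_float + R⁺_float + R_S + R_N, no Manin input

Width prover seat `bsd-line-fkl-p2` g14 (2026-08-28), `--supports stmt-BirchSwinnertonDyer-23715` (helper).  THEOREMS ONLY (no definition, no named
fact introduced, no `sorry`).  BSD is not proved by any of this; every statement is CONDITIONAL by design (PRINT named facts Gross–Zagier `gross_zagier`,
Kolyvagin `kolyvagin`, modularity `exists_isNewformOf`, Hoffstein–Luo `HoffsteinLuo1997_exists_twist_L_one_ne_zero`, Gross 1991 Prop. 3.7 (2); the route's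
four rank-`0` cruxes BY NAME; the conjecture-grade residue statements R⁻_float, R⁺_float, R_S, R_N as displayed HYPOTHESES; and for the converse direction
the rank-`0` `2`-converse `hconv`, OPEN at `2`).

Companion of `…OneDoorSubsliceNegDiscFloat.lean` (same seat: on {`Δ_W < 0`, `Ш(W)[2] = 0`} the floating-exponent R⁻ covers every datum).  Here the
`Δ_W > 0` EGG class: at a desc-admissible (`t = s = 0`, minimal at `Δ_W > 0`) door with `#Sel₂(W^{(d_K)}) = 1` the lawful identity reads
`2m = 0 + 0 + 0 + 2·v₂(c)`, i.e. `m = v₂(c)` for EVERY datum; the door is SUPPLIED for egg curves (route GenusKolyvaginAtTwo: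
`GenusKolyTwin.exists_silent_prime_heegnerField` gives a desc-admissible Heegner `K = ℚ(√−ℓ)`, and T-C `GenusKolyArch.eggTwistLawAtTwo_holds` makes its
twin `Sel₂`-trivial when `E(ℚ)` meets the egg), a datum exists by modularity.

* §1 **`hasLawfulDoorAtTwo_of_exponent_eq_padicVal_at_pos`** (per datum, Gross–Zagier + modularity only) and `bsdp_two_of_exponent_eq_padicVal_at_pos`;
* §2 **`bsdp_two_of_posDiscFloat`** — R⁺_float (hypothesis `hPf`: ∀ W of the slice with `Δ_W > 0`, `Ш(W)[2] = 0`, `MeetsEgg`, ∀ imaginary quadratic `K`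
  with `d_K` desc-admissible and `#Sel₂(W^{(d_K)}) = 1`, ∀ datum: exponent `= v₂(c)`) gives `BSDp W 2` on ALL of the egg class, NO odd-datum hypothesis, NO
  Manin input (for odd `c` the conclusion is exponent `0`, which AN-13 delivers via the egg lemma);
* §3 the converse: **`exponent_eq_padicVal_of_bsdp_two_of_twoConverse_at_pos`**, `posDiscFloat_of_rankOneAtTwoBigImageOddLocal_of_twoConverse` (lossless);
* §4 **THE MANIN-FREE COMPOSITION**: `doorIndexLawFullCAtTwoSomeDoorOffSubslice_of_floats_of_rest` (v8.14's residue from R⁻_float, R⁺_float and the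
  residue OFF {`Ш(W)[2] = 0` ∧ (`Δ_W < 0` ∨ `MeetsEgg`)}), `rest_of_sha_of_nonEgg` (that rest = R_S ∧ R_N, NO third population), and
  **`rankOneAtTwoBigImageOddLocal_of_floats_of_sha_of_nonEgg`** — the crux BY NAME from PRINT⁵ + rank-`0` cruxes + R⁻_float + R⁺_float + R_S + R_N — and
  the LOSSLESS TABLE `rankOneAtTwoBigImageOddLocal_iff_floats_sha_nonEgg_of_twoConverse` (crux ⟺ the four, modulo PRINT⁵ + rank-`0` + the rank-`0` `2`-converse).

References: [GrossZagier1986] Thm. I.6.3, V.§2; [GrossLMS1991] §§2–3, §10, Conj. 1.2; [Kolyvagin1990] Thm. A; [Kramer1981] Prop. 6; [MazurRubin2010]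
Prop. 3.3, Cor. 3.4 (i); [Zhang2014CJM] Thm. 1.1 (shape).
-/

set_option autoImplicit false
-- the Theorems namespace of this sub repeats the summit name by design (D-0017 nested layout)
set_option linter.dupNamespace false

noncomputable section

open scoped Classical

namespace Summit.BirchSwinnertonDyer.BirchSwinnertonDyer.Theorems.RankOneAtTwoOneDoor

open WeierstrassCurve NumberField Literature.NumberTheory.EllipticCurves Literature.NumberTheory.EllipticCurves.ModularForms
  Summit.BirchSwinnertonDyer.Rank1Residual.F1Sign2
  Summit.BirchSwinnertonDyer.Rank1Residual.F1Sign2.TranspositionDoor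
  Summit.BirchSwinnertonDyer.BirchSwinnertonDyer.Theses.ByReductionTypeAtTwo
open Summit.BirchSwinnertonDyer.BirchSwinnertonDyer.Theorems.GenusKolyTwin (exists_silent_prime_heegnerField)
open Summit.BirchSwinnertonDyer.BirchSwinnertonDyer.Theorems.GenusKolyArch (eggTwistLawAtTwo_holds)

/-! ### §1 Exponent `v₂(c)` at a `Sel₂`-trivial archimedean door is a lawful datum (`Δ_W > 0`), for any constant -/

/-- The lawful identity at a minimal `Δ_W > 0` door with `2`-torsion-free `Ш`'s and exponent `v₂(c)`: `2·v₂(c) + 0 = 0 + 0 + 0 + 2·v₂(c)`. [cite: GrossLMS1991, §10] -/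
theorem lawful_identity_at_padicVal_pos (W : WeierstrassCurve ℚ) [W.IsGloballyMinimal] (d : ℤ) (c : ℤ) (sW sd : ℕ) (hΔ : 0 < W.Δ)
    (hmin : transpCount W d + 2 * identCount W d = (if W.Δ < 0 then 1 else 0)) (hsW : sW = 0) (hsd : sd = 0) :
    2 * padicValInt 2 c + (if W.Δ < 0 then 1 else 0) = sW + sd + transpCount W d + 2 * identCount W d + 2 * padicValInt 2 c := by
  rw [if_neg (not_lt.mpr hΔ.le)] at hmin ⊢
  omega

/-- **EXPONENT `v₂(c)` AT A `Sel₂`-TRIVIAL DESC-ADMISSIBLE DOOR IS A LAWFUL DOOR DATUM (`Δ_W > 0`), FOR ANY CONSTANT.**  `W/ℚ` globally minimal of analytic rank `1`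
with `Δ_W > 0` and `Ш(W)[2] = 0`; `K` imaginary quadratic with `d_K` desc-admissible (door-admissible, `ANg16.doorAdmissible_of_descAdmissible`; minimal,
`minimal_of_descAdmissible_of_pos`) and `#Sel₂(W^{(d_K)}) = 1`; `Dt` of ANY constant, `H`, `ι`, `P` over the complex Heegner point with exponent `v₂(c)`.  THEN
`W` admits a lawful door datum (door opens itself at any exponent; `Ш(Wd)[2^∞] = 0` on a minimal model; identity with `m = v₂(c)`).  CONDITIONAL on `gross_zagier`
at `K` and `exists_isNewformOf` only. [cite: GrossZagier1986, Thm. I.6.3 and V.§2] [cite: Kramer1981, Prop. 6] [cite: GrossLMS1991, §§2–3 and §10] -/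
theorem hasLawfulDoorAtTwo_of_exponent_eq_padicVal_at_pos (hnf : exists_isNewformOf)
    (W : WeierstrassCurve ℚ) [W.IsElliptic] [W.IsGloballyMinimal] [NeZero (W.conductorNorm ℤ)] (hr : W.analyticRank = 1)
    (hΔ : 0 < W.Δ) (hSha : ShaTwoTrivial W)
    (K : Type) [iF : Field K] [iN : NumberField K] (hK : IsImaginaryQuadratic K) (hGZ : gross_zagier (W.conductorNorm ℤ) W K)
    (hDA : DescAdmissible W (NumberField.discr K)) (hsel : twistSelmerTwoCard W (NumberField.discr K) = 1)
    (Dt : ModularParametrizationData W (W.conductorNorm ℤ)) (H : HeegnerDatum (W.conductorNorm ℤ) (NumberField.discr K)) (ι : K →+* ℂ)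
    (P : (W.baseChange K).toAffine.Point) (hP : WeierstrassCurve.Affine.Point.map ι.toRatAlgHom P = heegnerPointComplex Dt H)
    (hm : HasTwoDivisibilityUpToTorsion W K P (padicValInt 2 Dt.c)) : HasLawfulDoorAtTwo W := by
  have hadm : DoorAdmissible W (NumberField.discr K) := ANg16.doorAdmissible_of_descAdmissible W hDA
  have hmin : transpCount W (NumberField.discr K) + 2 * identCount W (NumberField.discr K) = (if W.Δ < 0 then 1 else 0) :=
    minimal_of_descAdmissible_of_pos W hΔ hDA
  have hHN : SatisfiesHeegnerHypothesis (W.conductorNorm ℤ) K := satisfiesHeegnerHypothesis_of_doorAdmissible W K hK hadm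
  have hLt : (W.quadraticTwist (NumberField.discr K : ℚ)).entireLFunction 1 ≠ 0 :=
    twist_entireLFunction_ne_zero_of_hasTwoDivisibilityUpToTorsion hnf W hr K hK hGZ hHN Dt H ι P hP _ hm
  have hD0 : (NumberField.discr K : ℚ) ≠ 0 := by exact_mod_cast NumberField.discr_ne_zero K
  haveI hEt : (W.quadraticTwist (NumberField.discr K : ℚ)).IsElliptic := W.isElliptic_quadraticTwist hD0
  obtain ⟨Cd, hCd⟩ := hasGlobalMinimalModel_rat_holds (W.quadraticTwist (NumberField.discr K : ℚ))
  haveI := hCd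
  obtain ⟨-, -, hbotd⟩ := twist_arith_of_selmerTrivial W hD0 hsel (Cd • W.quadraticTwist (NumberField.discr K : ℚ)) Cd rfl
  have hsd : padicValNat 2 (Nat.card (AddCommGroup.primaryComponent (Cd • W.quadraticTwist (NumberField.discr K : ℚ)).sha 2)) = 0 := by
    rw [hbotd, AddSubgroup.card_bot]; simp
  have hsW : padicValNat 2 (Nat.card (AddCommGroup.primaryComponent W.sha 2)) = 0 :=
    padicValNat_card_primaryComponent_sha_two_eq_zero_of_shaTwoTrivial W hSha
  unfold HasLawfulDoorAtTwo
  exact ⟨K, iF, iN, hK, hadm, hLt, Dt, H, ι, P, Cd • W.quadraticTwist (NumberField.discr K : ℚ), inferInstance, hCd, Cd, hP, rfl,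
    padicValInt 2 Dt.c, hm, lawful_identity_at_padicVal_pos W (NumberField.discr K) Dt.c _ _ hΔ hmin hsW hsd⟩

/-- **`BSDp W 2` FROM EXPONENT `v₂(c)` AT A `Sel₂`-TRIVIAL DESC-ADMISSIBLE DOOR (`Δ_W > 0`), ANY DATUM**, modulo the four primary printed facts and the route's four
rank-`0` cruxes BY NAME.  CONDITIONAL by design. [cite: GrossZagier1986, Thm. I.6.3 and V.§2] [cite: GrossLMS1991, Conj. 1.2 and §3] [cite: Kolyvagin1990, Thm. A] -/
theorem bsdp_two_of_exponent_eq_padicVal_at_pos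
    (hGZ : ∀ (N : ℕ) [NeZero N] (W : WeierstrassCurve ℚ) (K : Type) [Field K] [NumberField K], gross_zagier N W K)
    (hKo : ∀ (N : ℕ) [NeZero N] (W : WeierstrassCurve ℚ) (K : Type) [Field K] [NumberField K], kolyvagin N W K)
    (hnf : exists_isNewformOf) (hHL : HoffsteinLuo1997_exists_twist_L_one_ne_zero)
    (hZ4 : GoodOrdinaryRankZeroAtTwo ∧ MultiplicativeRankZeroAtTwo ∧ SupersingularRankZeroAtTwo ∧ AdditiveRankZeroAtTwo)
    (W : WeierstrassCurve ℚ) [W.IsElliptic] [W.IsGloballyMinimal] [NeZero (W.conductorNorm ℤ)]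
    (hCM : ¬ W.HasCM) (hT : Odd W.torsionOrder) (hc : Odd W.tamagawaProduct) (hr : W.analyticRank = 1) (hΔ : 0 < W.Δ) (hSha : ShaTwoTrivial W)
    (K : Type) [Field K] [NumberField K] (hK : IsImaginaryQuadratic K)
    (hDA : DescAdmissible W (NumberField.discr K)) (hsel : twistSelmerTwoCard W (NumberField.discr K) = 1)
    (Dt : ModularParametrizationData W (W.conductorNorm ℤ)) (H : HeegnerDatum (W.conductorNorm ℤ) (NumberField.discr K)) (ι : K →+* ℂ)
    (P : (W.baseChange K).toAffine.Point) (hP : WeierstrassCurve.Affine.Point.map ι.toRatAlgHom P = heegnerPointComplex Dt H)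
    (hm : HasTwoDivisibilityUpToTorsion W K P (padicValInt 2 Dt.c)) : BSDp W 2 :=
  bsdp_two_of_hasLawfulDoorAtTwo_of_rankZero_cruxes hGZ hKo hnf hHL hZ4 W hCM hT hc hr
    (hasLawfulDoorAtTwo_of_exponent_eq_padicVal_at_pos hnf W hr hΔ hSha K hK (hGZ _ W K) hDA hsel Dt H ι P hP hm)

/-! ### §2 The floating-constant R⁺ covers ALL of the egg class {`Δ_W > 0`, `Ш(W)[2] = 0`, `MeetsEgg`}: no Manin input -/

/-- **`BSDp W 2` ON ALL OF THE EGG CLASS FROM THE FLOATING-CONSTANT R⁺** (`hPf`: for every curve of the slice with `Δ_W > 0`, `Ш(W)[2] = 0`, `MeetsEgg`, every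
imaginary quadratic `K` with `d_K` desc-admissible and `#Sel₂(W^{(d_K)}) = 1`, every datum: exponent `= v₂(c)`), modulo the four primary printed facts and the four
rank-`0` cruxes — NO odd-constant datum, NO Manin input.  The door is SUPPLIED: `GenusKolyTwin.exists_silent_prime_heegnerField` (silent prime `ℓ ≡ 7 (8)`,
`K = ℚ(√−ℓ)`, `d_K = −ℓ` desc-admissible, Heegner — from `ρ̄_{W,2}` onto, unconditional) and T-C `GenusKolyArch.eggTwistLawAtTwo_holds` (`MeetsEgg ⟹ #Sel₂(W^{(d)}) = 1`
at every desc-admissible `d`, for rank one, `Ш[2] = 0`, `E(ℚ)[2] = 0` — tree theorem); a datum by modularity; the `K`-point by `heegnerPointComplex_mem_range_map_holds`;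
then §1.  CONDITIONAL by design; nothing is asserted about `hPf`. [cite: Zhang2014CJM, Thm. 1.1 (shape)] [cite: Kramer1981, Prop. 6]
[cite: GrossZagier1986, Thm. I.6.3 and V.§2] -/
theorem bsdp_two_of_posDiscFloat
    (hGZ : ∀ (N : ℕ) [NeZero N] (W : WeierstrassCurve ℚ) (K : Type) [Field K] [NumberField K], gross_zagier N W K)
    (hKo : ∀ (N : ℕ) [NeZero N] (W : WeierstrassCurve ℚ) (K : Type) [Field K] [NumberField K], kolyvagin N W K)
    (hnf : exists_isNewformOf) (hHL : HoffsteinLuo1997_exists_twist_L_one_ne_zero)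
    (hZ4 : GoodOrdinaryRankZeroAtTwo ∧ MultiplicativeRankZeroAtTwo ∧ SupersingularRankZeroAtTwo ∧ AdditiveRankZeroAtTwo)
    (hPf : ∀ (W : WeierstrassCurve ℚ) [W.IsElliptic] [W.IsGloballyMinimal] [NeZero (W.conductorNorm ℤ)],
      ¬ W.HasCM → (∀ n : ℕ, W.HasSurjectiveModNGaloisRep ((2 ^ n : ℕ) : ℤ)) → Odd W.torsionOrder → Odd W.tamagawaProduct →
      W.analyticRank = 1 → 0 < W.Δ → ShaTwoTrivial W → MeetsEgg W →
      ∀ (K : Type) [Field K] [NumberField K], IsImaginaryQuadratic K →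
        DescAdmissible W (NumberField.discr K) → twistSelmerTwoCard W (NumberField.discr K) = 1 →
          ∀ (Dt : ModularParametrizationData W (W.conductorNorm ℤ)) (H : HeegnerDatum (W.conductorNorm ℤ) (NumberField.discr K)) (ι : K →+* ℂ)
            (P : (W.baseChange K).toAffine.Point),
            WeierstrassCurve.Affine.Point.map ι.toRatAlgHom P = heegnerPointComplex Dt H →
            HasTwoDivisibilityUpToTorsion W K P (padicValInt 2 Dt.c))
    (W : WeierstrassCurve ℚ) [W.IsElliptic] [W.IsGloballyMinimal] [NeZero (W.conductorNorm ℤ)]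
    (hCM : ¬ W.HasCM) (hsurj : ∀ n : ℕ, W.HasSurjectiveModNGaloisRep ((2 ^ n : ℕ) : ℤ)) (hT : Odd W.torsionOrder)
    (hc : Odd W.tamagawaProduct) (hr : W.analyticRank = 1) (hΔ : 0 < W.Δ) (hSha : ShaTwoTrivial W) (hmeets : MeetsEgg W) : BSDp W 2 := by
  have hT2 : NoRationalTwoTorsion W := noRationalTwoTorsion_of_odd_torsionOrder W hT
  have hrQ : W.mordellWeilRank = 1 := (mordellWeilRank_eq_one_of_analyticRank_eq_one_of_isGloballyMinimal hGZ hKo hnf hHL W hr).1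
  -- the door: a silent prime `ℓ`, `K = ℚ(√-ℓ)`, `d_K = -ℓ` desc-admissible, Heegner; its twin is `Sel₂`-trivial by T-C
  have hsurj2 : W.HasSurjectiveModNGaloisRep 2 := by simpa using hsurj 1
  obtain ⟨ℓ, -, -, -, -, -, hDA, -, K, iF, iN, hK, hd, -, -, hHN, -, -, -⟩ := exists_silent_prime_heegnerField W hΔ hsurj2 0
  rw [← hd] at hDA
  have hsel : twistSelmerTwoCard W (NumberField.discr K) = 1 := (eggTwistLawAtTwo_holds W hΔ hT2 hrQ hSha _ hDA).1 hmeets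
  -- a datum (modularity), the Heegner datum, an embedding, the `K`-rational point
  obtain ⟨Dt⟩ := (nonempty_modularParametrizationData_iff_exists_isNewformOf_unconditional.mpr hnf) W
  obtain ⟨H, -⟩ :=
    nonempty_heegnerDatum_holds (W.conductorNorm ℤ) K hK (exists_dvd_sq_sub_discr_holds (W.conductorNorm ℤ) K hK hHN).choose_spec
  obtain ⟨ι⟩ : Nonempty (K →+* ℂ) := inferInstance
  obtain ⟨P, hP⟩ := heegnerPointComplex_mem_range_map_holds (W.conductorNorm ℤ) W K hK hHN Dt H ι
  exact bsdp_two_of_exponent_eq_padicVal_at_pos hGZ hKo hnf hHL hZ4 W hCM hT hc hr hΔ hSha K hK hDA hsel Dt H ι P hP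
    (hPf W hCM hsurj hT hc hr hΔ hSha hmeets K hK hDA hsel Dt H ι P hP)

/-! ### §3 The converse: exponent `v₂(c)` from `BSD₂(W)` and the twin's rank-`0` `2`-converse (lossless) -/

/-- **`BSDp W 2` + the twin's rank-`0` `2`-converse ⟹ exponent `v₂(c)`** at a `Sel₂`-trivial desc-admissible door (`Δ_W > 0`), ANY datum: twin corank `0`,
hence analytic rank `0`, door open, `BSDp Wd 2`; the per-datum kernel iff gives `m` with `2m = 0 + 0 + 0 + 2·v₂(c)`.  CONDITIONAL by design.
[cite: Zhang2014CJM, Thm. 1.1 (shape)] [cite: Kramer1981, Prop. 6] [cite: BurungaleSkinnerTianWan2024, Thm. 4.3 (p odd)] -/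
theorem exponent_eq_padicVal_of_bsdp_two_of_twoConverse_at_pos
    (hGZ : ∀ (N : ℕ) [NeZero N] (W : WeierstrassCurve ℚ) (K : Type) [Field K] [NumberField K], gross_zagier N W K)
    (hKo : ∀ (N : ℕ) [NeZero N] (W : WeierstrassCurve ℚ) (K : Type) [Field K] [NumberField K], kolyvagin N W K)
    (hnf : exists_isNewformOf) (hHL : HoffsteinLuo1997_exists_twist_L_one_ne_zero) (hZ : S_rankZeroTwin)
    (W : WeierstrassCurve ℚ) [W.IsElliptic] [W.IsGloballyMinimal] [NeZero (W.conductorNorm ℤ)]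
    (hCM : ¬ W.HasCM) (hT : Odd W.torsionOrder) (hc : Odd W.tamagawaProduct) (hr : W.analyticRank = 1)
    (hΔ : 0 < W.Δ) (hSha : ShaTwoTrivial W) (hB : BSDp W 2)
    (K : Type) [Field K] [NumberField K] (hK : IsImaginaryQuadratic K)
    (hDA : DescAdmissible W (NumberField.discr K)) (hsel : twistSelmerTwoCard W (NumberField.discr K) = 1)
    (Dt : ModularParametrizationData W (W.conductorNorm ℤ)) (H : HeegnerDatum (W.conductorNorm ℤ) (NumberField.discr K)) (ι : K →+* ℂ)
    (P : (W.baseChange K).toAffine.Point) (hP : WeierstrassCurve.Affine.Point.map ι.toRatAlgHom P = heegnerPointComplex Dt H)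
    (Wd : WeierstrassCurve ℚ) [Wd.IsElliptic] [Wd.IsGloballyMinimal] (Cd : VariableChange ℚ)
    (hWd : Cd • W.quadraticTwist (NumberField.discr K : ℚ) = Wd) (hconv : ¬ Wd.HasCM → Wd.selmerCorank 2 = 0 → Wd.analyticRank = 0) :
    HasTwoDivisibilityUpToTorsion W K P (padicValInt 2 Dt.c) := by
  have hmod : hasEntireLFunction_rat := hasEntireLFunction_rat_of_exists_isNewformOf hnf
  have hrQ : W.mordellWeilRank = 1 := (mordellWeilRank_eq_one_of_analyticRank_eq_one_of_isGloballyMinimal hGZ hKo hnf hHL W hr).1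
  have hadm : DoorAdmissible W (NumberField.discr K) := ANg16.doorAdmissible_of_descAdmissible W hDA
  have hmin : transpCount W (NumberField.discr K) + 2 * identCount W (NumberField.discr K) = (if W.Δ < 0 then 1 else 0) :=
    minimal_of_descAdmissible_of_pos W hΔ hDA
  have hHN : SatisfiesHeegnerHypothesis (W.conductorNorm ℤ) K := satisfiesHeegnerHypothesis_of_doorAdmissible W K hK hadm
  have hD0 : (NumberField.discr K : ℚ) ≠ 0 := by exact_mod_cast NumberField.discr_ne_zero K
  haveI hEt : (W.quadraticTwist (NumberField.discr K : ℚ)).IsElliptic := W.isElliptic_quadraticTwist hD0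
  have hCMd : ¬ Wd.HasCM := RamifiedPairUpperBound.not_hasCM_of_smul_quadraticTwist_eq hD0 hWd hCM
  have hrd : Wd.analyticRank = 0 := hconv hCMd (twin_selmerCorank_two_eq_zero_of_twistSelmerTwoCard_eq_one W hsel Wd Cd hWd)
  have hLeq : Wd.entireLFunction = (W.quadraticTwist (NumberField.discr K : ℚ)).entireLFunction := by
    rw [← hWd, entireLFunction_smul]
  have hLt : (W.quadraticTwist (NumberField.discr K : ℚ)).entireLFunction 1 ≠ 0 := by
    rw [← hLeq]
    exact (Wd.analyticRank_eq_zero_iff_holds (hmod Wd)).1 hrd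
  have hBd : BSDp Wd 2 := hZ Wd hCMd hrd
  obtain ⟨-, -, hiff⟩ :=
    bsdp_two_iff_doorLawFullC_at_of_rank hmod doorTwistTamagawaAtTwo W hT hc hr hrQ K hK (hGZ _ W K) (hKo _ W K) hadm hHN hLt Dt H ι P hP Wd Cd hWd hBd
  obtain ⟨m, hm, hlaw⟩ := hiff.mp hB
  have hsW : padicValNat 2 (Nat.card (AddCommGroup.primaryComponent W.sha 2)) = 0 :=
    padicValNat_card_primaryComponent_sha_two_eq_zero_of_shaTwoTrivial W hSha
  obtain ⟨-, -, hbotd⟩ := twist_arith_of_selmerTrivial W hD0 hsel Wd Cd hWd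
  have hsd : padicValNat 2 (Nat.card (AddCommGroup.primaryComponent Wd.sha 2)) = 0 := by
    rw [hbotd, AddSubgroup.card_bot]; simp
  rw [hsW, hsd, if_neg (not_lt.mpr hΔ.le)] at hlaw
  rw [if_neg (not_lt.mpr hΔ.le)] at hmin
  have hmv : m = padicValInt 2 Dt.c := by omega
  rw [← hmv]
  exact hm

/-- **R⁺_float FROM THE CRUX** (modulo PRINT⁴ + rank-`0` cruxes + the reduction-type-free rank-`0` `2`-converse `hconv`, OPEN at `2`): with
`bsdp_two_of_posDiscFloat`, R⁺_float is EQUIVALENT to `BSD₂` on the egg class modulo those inputs — lossless and Manin-free.  CONDITIONAL by design.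
[cite: Zhang2014CJM, Thm. 1.1] [cite: GrossLMS1991, Conj. 1.2 and §10] -/
theorem posDiscFloat_of_rankOneAtTwoBigImageOddLocal_of_twoConverse
    (hGZ : ∀ (N : ℕ) [NeZero N] (W : WeierstrassCurve ℚ) (K : Type) [Field K] [NumberField K], gross_zagier N W K)
    (hKo : ∀ (N : ℕ) [NeZero N] (W : WeierstrassCurve ℚ) (K : Type) [Field K] [NumberField K], kolyvagin N W K)
    (hnf : exists_isNewformOf) (hHL : HoffsteinLuo1997_exists_twist_L_one_ne_zero)
    (hZ4 : GoodOrdinaryRankZeroAtTwo ∧ MultiplicativeRankZeroAtTwo ∧ SupersingularRankZeroAtTwo ∧ AdditiveRankZeroAtTwo)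
    (hconv : ∀ (V : WeierstrassCurve ℚ) [V.IsElliptic] [V.IsGloballyMinimal], ¬ V.HasCM → V.selmerCorank 2 = 0 → V.analyticRank = 0)
    (hX : RankOneAtTwoBigImageOddLocal) :
    ∀ (W : WeierstrassCurve ℚ) [W.IsElliptic] [W.IsGloballyMinimal] [NeZero (W.conductorNorm ℤ)],
      ¬ W.HasCM → (∀ n : ℕ, W.HasSurjectiveModNGaloisRep ((2 ^ n : ℕ) : ℤ)) → Odd W.torsionOrder → Odd W.tamagawaProduct →
      W.analyticRank = 1 → 0 < W.Δ → ShaTwoTrivial W → MeetsEgg W →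
      ∀ (K : Type) [Field K] [NumberField K], IsImaginaryQuadratic K →
        DescAdmissible W (NumberField.discr K) → twistSelmerTwoCard W (NumberField.discr K) = 1 →
          ∀ (Dt : ModularParametrizationData W (W.conductorNorm ℤ)) (H : HeegnerDatum (W.conductorNorm ℤ) (NumberField.discr K)) (ι : K →+* ℂ)
            (P : (W.baseChange K).toAffine.Point),
            WeierstrassCurve.Affine.Point.map ι.toRatAlgHom P = heegnerPointComplex Dt H →
            HasTwoDivisibilityUpToTorsion W K P (padicValInt 2 Dt.c) := by
  intro W _ _ _ hCM hsurj hT hc hr hΔ hSha _ K _ _ hK hDA hsel Dt H ι P hP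
  have hB : BSDp W 2 := hX W hCM hsurj hT hc hr
  have hD0 : (NumberField.discr K : ℚ) ≠ 0 := by exact_mod_cast NumberField.discr_ne_zero K
  haveI hEt : (W.quadraticTwist (NumberField.discr K : ℚ)).IsElliptic := W.isElliptic_quadraticTwist hD0
  obtain ⟨Cd, hCd⟩ := hasGlobalMinimalModel_rat_holds (W.quadraticTwist (NumberField.discr K : ℚ))
  haveI := hCd
  exact exponent_eq_padicVal_of_bsdp_two_of_twoConverse_at_pos hGZ hKo hnf hHL (fun V _ _ hVCM hV0 => bsdp_two_of_rankZero_cruxes hZ4 V hVCM hV0)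
    W hCM hT hc hr hΔ hSha hB K hK hDA hsel Dt H ι P hP (Cd • W.quadraticTwist (NumberField.discr K : ℚ)) Cd rfl (fun hVCM hV0 => hconv _ hVCM hV0)

/-! ### §4 The Manin-free composition: crux ⟸ PRINT⁵ + rank-`0` + R⁻_float + R⁺_float + R_S + R_N -/

/-- **v8.14's residue from the two FLOATING-CONSTANT statements and the residue OFF {`Ш(W)[2] = 0` ∧ (`Δ_W < 0` ∨ `MeetsEgg`)}.**  On {`Δ_W < 0`, `Ш[2] = 0`}
R⁻_float gives `BSDp W 2` (`bsdp_two_of_negDiscFloat`), on {`Δ_W > 0`, `Ш[2] = 0`, egg} R⁺_float does (`bsdp_two_of_posDiscFloat`), hence a lawful datum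
(`hasLawfulDoorAtTwo_of_bsdp_two`); elsewhere `hrest`.  NO odd-constant conjunct anywhere.  CONDITIONAL by design (PRINT⁴ + rank-`0` cruxes as hypotheses).
[cite: GrossLMS1991, Conj. 1.2, §3 and §10] [cite: Zhang2014CJM, Thm. 1.1 (shape)] -/
theorem doorIndexLawFullCAtTwoSomeDoorOffSubslice_of_floats_of_rest
    (hGZ : ∀ (N : ℕ) [NeZero N] (W : WeierstrassCurve ℚ) (K : Type) [Field K] [NumberField K], gross_zagier N W K)
    (hKo : ∀ (N : ℕ) [NeZero N] (W : WeierstrassCurve ℚ) (K : Type) [Field K] [NumberField K], kolyvagin N W K)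
    (hnf : exists_isNewformOf) (hHL : HoffsteinLuo1997_exists_twist_L_one_ne_zero)
    (hZ4 : GoodOrdinaryRankZeroAtTwo ∧ MultiplicativeRankZeroAtTwo ∧ SupersingularRankZeroAtTwo ∧ AdditiveRankZeroAtTwo)
    (hRf : ∀ (W : WeierstrassCurve ℚ) [W.IsElliptic] [W.IsGloballyMinimal] [NeZero (W.conductorNorm ℤ)],
      ¬ W.HasCM → (∀ n : ℕ, W.HasSurjectiveModNGaloisRep ((2 ^ n : ℕ) : ℤ)) → Odd W.torsionOrder → Odd W.tamagawaProduct →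
      W.analyticRank = 1 → W.Δ < 0 → ShaTwoTrivial W →
      ∀ (K : Type) [Field K] [NumberField K], IsImaginaryQuadratic K →
        ∀ (q₀ : ℕ) [Fact q₀.Prime], TranspAdmissible W (NumberField.discr K) q₀ → twistSelmerTwoCard W (NumberField.discr K) = 1 →
          ∀ (Dt : ModularParametrizationData W (W.conductorNorm ℤ)) (H : HeegnerDatum (W.conductorNorm ℤ) (NumberField.discr K)) (ι : K →+* ℂ)
            (P : (W.baseChange K).toAffine.Point),
            WeierstrassCurve.Affine.Point.map ι.toRatAlgHom P = heegnerPointComplex Dt H →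
            HasTwoDivisibilityUpToTorsion W K P (padicValInt 2 Dt.c))
    (hPf : ∀ (W : WeierstrassCurve ℚ) [W.IsElliptic] [W.IsGloballyMinimal] [NeZero (W.conductorNorm ℤ)],
      ¬ W.HasCM → (∀ n : ℕ, W.HasSurjectiveModNGaloisRep ((2 ^ n : ℕ) : ℤ)) → Odd W.torsionOrder → Odd W.tamagawaProduct →
      W.analyticRank = 1 → 0 < W.Δ → ShaTwoTrivial W → MeetsEgg W →
      ∀ (K : Type) [Field K] [NumberField K], IsImaginaryQuadratic K →
        DescAdmissible W (NumberField.discr K) → twistSelmerTwoCard W (NumberField.discr K) = 1 →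
          ∀ (Dt : ModularParametrizationData W (W.conductorNorm ℤ)) (H : HeegnerDatum (W.conductorNorm ℤ) (NumberField.discr K)) (ι : K →+* ℂ)
            (P : (W.baseChange K).toAffine.Point),
            WeierstrassCurve.Affine.Point.map ι.toRatAlgHom P = heegnerPointComplex Dt H →
            HasTwoDivisibilityUpToTorsion W K P (padicValInt 2 Dt.c))
    (hrest : ∀ (W : WeierstrassCurve ℚ) [W.IsElliptic] [W.IsGloballyMinimal] [NeZero (W.conductorNorm ℤ)],
      ¬ W.HasCM → (∀ n : ℕ, W.HasSurjectiveModNGaloisRep ((2 ^ n : ℕ) : ℤ)) → Odd W.torsionOrder → Odd W.tamagawaProduct →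
      W.analyticRank = 1 → ¬ HasBottomRungDoorAtTwo W → ¬ (ShaTwoTrivial W ∧ (W.Δ < 0 ∨ MeetsEgg W)) → HasLawfulDoorAtTwo W) :
    DoorIndexLawFullCAtTwoSomeDoorOffSubslice := by
  intro W _ _ _ hCM hsurj hT hc hr hoff
  by_cases hcls : ShaTwoTrivial W ∧ (W.Δ < 0 ∨ MeetsEgg W)
  · obtain ⟨hSha, hor⟩ := hcls
    have hZ : S_rankZeroTwin := fun V _ _ hVCM hV0 => bsdp_two_of_rankZero_cruxes hZ4 V hVCM hV0
    rcases lt_or_gt_of_ne W.isUnit_Δ.ne_zero with hΔ | hΔ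
    · exact hasLawfulDoorAtTwo_of_bsdp_two hGZ hKo hnf hHL hZ W hCM hT hc hr
        (bsdp_two_of_negDiscFloat hGZ hKo hnf hHL hZ4 hRf W hCM hsurj hT hc hr hΔ hSha)
    · have hme : MeetsEgg W := hor.resolve_left (not_lt.mpr hΔ.le)
      exact hasLawfulDoorAtTwo_of_bsdp_two hGZ hKo hnf hHL hZ W hCM hT hc hr
        (bsdp_two_of_posDiscFloat hGZ hKo hnf hHL hZ4 hPf W hCM hsurj hT hc hr hΔ hSha hme)
  · exact hrest W hCM hsurj hT hc hr hoff hcls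

/-- **The rest is R_S ∧ R_N — NO third population.**  A curve of the slice off {`Ш(W)[2] = 0` ∧ (`Δ_W < 0` ∨ `MeetsEgg`)} has `Ш(W)[2] ≠ 0` (population S,
24882-type) or `Δ_W > 0`, `Ш(W)[2] = 0` and `E(ℚ) ⊂ E⁰(ℝ)` (population N, 24883-type); the «no odd-constant datum» population of `…ResiduePlusPlusSplit.lean`
has been absorbed by the floating exponents.  Import-free case analysis (`Δ_W ≠ 0`). [cite: GrossLMS1991, Conj. 1.2 and §10] -/
theorem rest_of_sha_of_nonEgg
    (hS : ∀ (W : WeierstrassCurve ℚ) [W.IsElliptic] [W.IsGloballyMinimal] [NeZero (W.conductorNorm ℤ)],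
      ¬ W.HasCM → (∀ n : ℕ, W.HasSurjectiveModNGaloisRep ((2 ^ n : ℕ) : ℤ)) → Odd W.torsionOrder → Odd W.tamagawaProduct →
      W.analyticRank = 1 → ¬ ShaTwoTrivial W → HasLawfulDoorAtTwo W)
    (hN : ∀ (W : WeierstrassCurve ℚ) [W.IsElliptic] [W.IsGloballyMinimal] [NeZero (W.conductorNorm ℤ)],
      ¬ W.HasCM → (∀ n : ℕ, W.HasSurjectiveModNGaloisRep ((2 ^ n : ℕ) : ℤ)) → Odd W.torsionOrder → Odd W.tamagawaProduct →
      W.analyticRank = 1 → 0 < W.Δ → ShaTwoTrivial W → ¬ MeetsEgg W → HasLawfulDoorAtTwo W) :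
    ∀ (W : WeierstrassCurve ℚ) [W.IsElliptic] [W.IsGloballyMinimal] [NeZero (W.conductorNorm ℤ)],
      ¬ W.HasCM → (∀ n : ℕ, W.HasSurjectiveModNGaloisRep ((2 ^ n : ℕ) : ℤ)) → Odd W.torsionOrder → Odd W.tamagawaProduct →
      W.analyticRank = 1 → ¬ HasBottomRungDoorAtTwo W → ¬ (ShaTwoTrivial W ∧ (W.Δ < 0 ∨ MeetsEgg W)) → HasLawfulDoorAtTwo W := by
  intro W _ _ _ hCM hsurj hT hc hr _ hcls
  by_cases hSha : ShaTwoTrivial W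
  · rcases lt_or_gt_of_ne W.isUnit_Δ.ne_zero with hΔ | hΔ
    · exact absurd ⟨hSha, Or.inl hΔ⟩ hcls
    · exact hN W hCM hsurj hT hc hr hΔ hSha (fun hme => hcls ⟨hSha, Or.inr hme⟩)
  · exact hS W hCM hsurj hT hc hr hSha

/-- **THE CRUX `RankOneAtTwoBigImageOddLocal` BY NAME, MANIN-FREE: PRINT⁵ + the route's four rank-`0` cruxes + R⁻_float + R⁺_float + R_S + R_N.**  The five
printed facts (Gross–Zagier, Kolyvagin, modularity, Hoffstein–Luo, Gross 1991 Prop. 3.7 (2) — the last only on the sub-slice branch of v8.14's composition);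
the FLOATING-CONSTANT non-divisibility statements R⁻_float (Kolyvagin's conjecture at `2` at a `Sel₂`-trivial transposition prime door, exponent `v₂(c)`, on
{`Δ_W < 0`, `Ш[2] = 0`}) and R⁺_float (the same at a `Sel₂`-trivial archimedean door on the egg class); R_S (lawful door on {`Ш(W)[2] ≠ 0`}: Kolyvagin exactness
beyond the first layer, 24882-type) and R_N (lawful door on {`Δ_W > 0`, `Ш[2] = 0`, non-egg}: the `η_f = 0` residual, 24883-type).  NO parametrisation-constant /
Manin hypothesis appears.  Through `rankOneAtTwoBigImageOddLocal_of_someDoorOffSubslice` (v8.14).  CONDITIONAL by design: BSD is not proved by this, and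
nothing is asserted about the four conjecture-grade inputs. [cite: GrossLMS1991, §10 and Conj. 1.2] [cite: Zhang2014CJM, Thm. 1.1 (shape)] [cite: Kolyvagin1990, Thm. A]
[cite: GrossZagier1986, Thm. I.6.3 and V.§2] [cite: Kramer1981, Prop. 6] -/
theorem rankOneAtTwoBigImageOddLocal_of_floats_of_sha_of_nonEgg
    (hGZ : ∀ (N : ℕ) [NeZero N] (W : WeierstrassCurve ℚ) (K : Type) [Field K] [NumberField K], gross_zagier N W K)
    (hKo : ∀ (N : ℕ) [NeZero N] (W : WeierstrassCurve ℚ) (K : Type) [Field K] [NumberField K], kolyvagin N W K)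
    (hnf : exists_isNewformOf) (hHL : HoffsteinLuo1997_exists_twist_L_one_ne_zero)
    (h37 : Literature.NumberTheory.EllipticCurves.GrossLMS1991.prop37_2_frobeniusCongruence)
    (hZ4 : GoodOrdinaryRankZeroAtTwo ∧ MultiplicativeRankZeroAtTwo ∧ SupersingularRankZeroAtTwo ∧ AdditiveRankZeroAtTwo)
    (hRf : ∀ (W : WeierstrassCurve ℚ) [W.IsElliptic] [W.IsGloballyMinimal] [NeZero (W.conductorNorm ℤ)],
      ¬ W.HasCM → (∀ n : ℕ, W.HasSurjectiveModNGaloisRep ((2 ^ n : ℕ) : ℤ)) → Odd W.torsionOrder → Odd W.tamagawaProduct →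
      W.analyticRank = 1 → W.Δ < 0 → ShaTwoTrivial W →
      ∀ (K : Type) [Field K] [NumberField K], IsImaginaryQuadratic K →
        ∀ (q₀ : ℕ) [Fact q₀.Prime], TranspAdmissible W (NumberField.discr K) q₀ → twistSelmerTwoCard W (NumberField.discr K) = 1 →
          ∀ (Dt : ModularParametrizationData W (W.conductorNorm ℤ)) (H : HeegnerDatum (W.conductorNorm ℤ) (NumberField.discr K)) (ι : K →+* ℂ)
            (P : (W.baseChange K).toAffine.Point),
            WeierstrassCurve.Affine.Point.map ι.toRatAlgHom P = heegnerPointComplex Dt H →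
            HasTwoDivisibilityUpToTorsion W K P (padicValInt 2 Dt.c))
    (hPf : ∀ (W : WeierstrassCurve ℚ) [W.IsElliptic] [W.IsGloballyMinimal] [NeZero (W.conductorNorm ℤ)],
      ¬ W.HasCM → (∀ n : ℕ, W.HasSurjectiveModNGaloisRep ((2 ^ n : ℕ) : ℤ)) → Odd W.torsionOrder → Odd W.tamagawaProduct →
      W.analyticRank = 1 → 0 < W.Δ → ShaTwoTrivial W → MeetsEgg W →
      ∀ (K : Type) [Field K] [NumberField K], IsImaginaryQuadratic K →
        DescAdmissible W (NumberField.discr K) → twistSelmerTwoCard W (NumberField.discr K) = 1 →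
          ∀ (Dt : ModularParametrizationData W (W.conductorNorm ℤ)) (H : HeegnerDatum (W.conductorNorm ℤ) (NumberField.discr K)) (ι : K →+* ℂ)
            (P : (W.baseChange K).toAffine.Point),
            WeierstrassCurve.Affine.Point.map ι.toRatAlgHom P = heegnerPointComplex Dt H →
            HasTwoDivisibilityUpToTorsion W K P (padicValInt 2 Dt.c))
    (hS : ∀ (W : WeierstrassCurve ℚ) [W.IsElliptic] [W.IsGloballyMinimal] [NeZero (W.conductorNorm ℤ)],
      ¬ W.HasCM → (∀ n : ℕ, W.HasSurjectiveModNGaloisRep ((2 ^ n : ℕ) : ℤ)) → Odd W.torsionOrder → Odd W.tamagawaProduct →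
      W.analyticRank = 1 → ¬ ShaTwoTrivial W → HasLawfulDoorAtTwo W)
    (hN : ∀ (W : WeierstrassCurve ℚ) [W.IsElliptic] [W.IsGloballyMinimal] [NeZero (W.conductorNorm ℤ)],
      ¬ W.HasCM → (∀ n : ℕ, W.HasSurjectiveModNGaloisRep ((2 ^ n : ℕ) : ℤ)) → Odd W.torsionOrder → Odd W.tamagawaProduct →
      W.analyticRank = 1 → 0 < W.Δ → ShaTwoTrivial W → ¬ MeetsEgg W → HasLawfulDoorAtTwo W) :
    RankOneAtTwoBigImageOddLocal :=
  rankOneAtTwoBigImageOddLocal_of_someDoorOffSubslice hGZ hKo hnf hHL h37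
    (doorIndexLawFullCAtTwoSomeDoorOffSubslice_of_floats_of_rest hGZ hKo hnf hHL hZ4 hRf hPf (rest_of_sha_of_nonEgg hS hN)) hZ4


/-- **THE LOSSLESS TABLE — crux ⟺ R⁻_float ∧ R⁺_float ∧ R_S ∧ R_N, modulo the five printed facts, the route's four rank-`0` cruxes BY NAME and the
reduction-type-free rank-`0` `2`-converse `hconv` (needed only for crux ⟹ floats; crux ⟹ R_S, R_N is `hasLawfulDoorAtTwo_of_bsdp_two`).**  Each of the
four statements is ONE mechanism: Kolyvagin's conjecture at `2` with floating exponent at a `Sel₂`-trivial transposition prime door (`Δ_W < 0`, `Ш[2] = 0`) /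
at a `Sel₂`-trivial archimedean door (egg class); Kolyvagin exactness beyond the first layer (`Ш(W)[2] ≠ 0`, 24882-type); the `Δ_W > 0` non-egg residual
(24883 / `η_f = 0`).  No parametrisation-constant or Manin statement appears on either side.  CONDITIONAL by design; BSD is not proved by this; nothing is
asserted about any of the four. [cite: GrossLMS1991, §10 and Conj. 1.2] [cite: Zhang2014CJM, Thm. 1.1 (shape)] [cite: BurungaleSkinnerTianWan2024, Thm. 4.3 (p odd)] -/
theorem rankOneAtTwoBigImageOddLocal_iff_floats_sha_nonEgg_of_twoConverse
    (hGZ : ∀ (N : ℕ) [NeZero N] (W : WeierstrassCurve ℚ) (K : Type) [Field K] [NumberField K], gross_zagier N W K)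
    (hKo : ∀ (N : ℕ) [NeZero N] (W : WeierstrassCurve ℚ) (K : Type) [Field K] [NumberField K], kolyvagin N W K)
    (hnf : exists_isNewformOf) (hHL : HoffsteinLuo1997_exists_twist_L_one_ne_zero)
    (h37 : Literature.NumberTheory.EllipticCurves.GrossLMS1991.prop37_2_frobeniusCongruence)
    (hZ4 : GoodOrdinaryRankZeroAtTwo ∧ MultiplicativeRankZeroAtTwo ∧ SupersingularRankZeroAtTwo ∧ AdditiveRankZeroAtTwo)
    (hconv : ∀ (V : WeierstrassCurve ℚ) [V.IsElliptic] [V.IsGloballyMinimal], ¬ V.HasCM → V.selmerCorank 2 = 0 → V.analyticRank = 0) :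
    RankOneAtTwoBigImageOddLocal ↔
      ((∀ (W : WeierstrassCurve ℚ) [W.IsElliptic] [W.IsGloballyMinimal] [NeZero (W.conductorNorm ℤ)],
      ¬ W.HasCM → (∀ n : ℕ, W.HasSurjectiveModNGaloisRep ((2 ^ n : ℕ) : ℤ)) → Odd W.torsionOrder → Odd W.tamagawaProduct →
      W.analyticRank = 1 → W.Δ < 0 → ShaTwoTrivial W →
      ∀ (K : Type) [Field K] [NumberField K], IsImaginaryQuadratic K →
        ∀ (q₀ : ℕ) [Fact q₀.Prime], TranspAdmissible W (NumberField.discr K) q₀ → twistSelmerTwoCard W (NumberField.discr K) = 1 →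
          ∀ (Dt : ModularParametrizationData W (W.conductorNorm ℤ)) (H : HeegnerDatum (W.conductorNorm ℤ) (NumberField.discr K)) (ι : K →+* ℂ)
            (P : (W.baseChange K).toAffine.Point),
            WeierstrassCurve.Affine.Point.map ι.toRatAlgHom P = heegnerPointComplex Dt H →
            HasTwoDivisibilityUpToTorsion W K P (padicValInt 2 Dt.c)) ∧
       (∀ (W : WeierstrassCurve ℚ) [W.IsElliptic] [W.IsGloballyMinimal] [NeZero (W.conductorNorm ℤ)],
      ¬ W.HasCM → (∀ n : ℕ, W.HasSurjectiveModNGaloisRep ((2 ^ n : ℕ) : ℤ)) → Odd W.torsionOrder → Odd W.tamagawaProduct →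
      W.analyticRank = 1 → 0 < W.Δ → ShaTwoTrivial W → MeetsEgg W →
      ∀ (K : Type) [Field K] [NumberField K], IsImaginaryQuadratic K →
        DescAdmissible W (NumberField.discr K) → twistSelmerTwoCard W (NumberField.discr K) = 1 →
          ∀ (Dt : ModularParametrizationData W (W.conductorNorm ℤ)) (H : HeegnerDatum (W.conductorNorm ℤ) (NumberField.discr K)) (ι : K →+* ℂ)
            (P : (W.baseChange K).toAffine.Point),
            WeierstrassCurve.Affine.Point.map ι.toRatAlgHom P = heegnerPointComplex Dt H →
            HasTwoDivisibilityUpToTorsion W K P (padicValInt 2 Dt.c)) ∧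
       (∀ (W : WeierstrassCurve ℚ) [W.IsElliptic] [W.IsGloballyMinimal] [NeZero (W.conductorNorm ℤ)],
      ¬ W.HasCM → (∀ n : ℕ, W.HasSurjectiveModNGaloisRep ((2 ^ n : ℕ) : ℤ)) → Odd W.torsionOrder → Odd W.tamagawaProduct →
      W.analyticRank = 1 → ¬ ShaTwoTrivial W → HasLawfulDoorAtTwo W) ∧
       (∀ (W : WeierstrassCurve ℚ) [W.IsElliptic] [W.IsGloballyMinimal] [NeZero (W.conductorNorm ℤ)],
      ¬ W.HasCM → (∀ n : ℕ, W.HasSurjectiveModNGaloisRep ((2 ^ n : ℕ) : ℤ)) → Odd W.torsionOrder → Odd W.tamagawaProduct →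
      W.analyticRank = 1 → 0 < W.Δ → ShaTwoTrivial W → ¬ MeetsEgg W → HasLawfulDoorAtTwo W)) := by
  have hZ : S_rankZeroTwin := fun V _ _ hVCM hV0 => bsdp_two_of_rankZero_cruxes hZ4 V hVCM hV0
  refine ⟨fun hX => ⟨?_, ?_, ?_, ?_⟩, fun h => rankOneAtTwoBigImageOddLocal_of_floats_of_sha_of_nonEgg hGZ hKo hnf hHL h37 hZ4 h.1 h.2.1 h.2.2.1 h.2.2.2⟩
  · exact negDiscFloat_of_rankOneAtTwoBigImageOddLocal_of_twoConverse hGZ hKo hnf hHL hZ4 hconv hX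
  · exact posDiscFloat_of_rankOneAtTwoBigImageOddLocal_of_twoConverse hGZ hKo hnf hHL hZ4 hconv hX
  · intro W _ _ _ hCM hsurj hT hc hr _
    exact hasLawfulDoorAtTwo_of_bsdp_two hGZ hKo hnf hHL hZ W hCM hT hc hr (hX W hCM hsurj hT hc hr)
  · intro W _ _ _ hCM hsurj hT hc hr _ _ _
    exact hasLawfulDoorAtTwo_of_bsdp_two hGZ hKo hnf hHL hZ W hCM hT hc hr (hX W hCM hsurj hT hc hr)

end Summit.BirchSwinnertonDyer.BirchSwinnertonDyer.Theorems.RankOneAtTwoOneDoor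

end
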